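import Mathlib
import Summits.KontsevichZagierPeriods.KontsevichZagierPeriods.Theorems.SoloInformedZetaOneTwoClass
import Literature.NumberTheory.Transcendental.MZVSimplexRepProofs
import Literature.NumberTheory.Transcendental.MultipleZetaProofs
import Literature.NumberTheory.Transcendental.MultipleZetaEulerProofs
import Literature.NumberTheory.Transcendental.MultipleZetaValuesProofs
import HarnessLib
import HarnessLib.Audit

/-!
# SoloInformed — the Kontsevich–Zagier period conjecture holds on the weight-3 MZV sector

Solo programme `solo-KontsevichZagierPeriods-informed`, session s45 (PART XVI, THEOREM XXXVI₃ — the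
weight-3 sibling of `SoloInformedKZPWeightFour`).

On the subgroup of `KZ.FormalRep` spanned by Kontsevich's simplex representations `Z(3), Z(2,1)`:

* `soloInformed_mzvRep3_class` — every weight-3 admissible `Z(s)` is `≡ Z(3)` modulo `KZ.relations`
  (the telescope chain `soloInformed_M21_sub_M3_mem_relations` of `SoloInformedZetaOneTwoClass`), and
  `ζ(s) = ζ(3) > 0` (Literature: `mzvRep_value_holds`, `euler_zeta_two_one_holds`,
  `multipleZeta_pos_of_isAdmissible_holds`, classification `MZV.eq_of_isAdmissible_of_weight_eq_three`);
* `soloInformed_kzp_mzvRep_weight3` — for admissible `s, s'` of weight `3`, `Z(s)` and `Z(s')` are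
  `KZ.Equivalent` (so a fortiori: equal values ⇒ equivalent);
* `soloInformed_kzp_weight3_span` — for all `a b : ℤ`:
  `eval (a·[Z(3)] + b·[Z(2,1)]) = 0 ↔ (that element) ∈ KZ.relations` — `ker eval = relations` on this
  rank-2 subgroup; the transcendence input is only `ζ(3) ≠ 0`.

What is NOT claimed: anything relating the weight-3 and weight-4 sectors (that would need
`ζ(3)/π⁴ ∉ ℚ`, open), or representations of `ζ(3)` other than the two simplex ones.
-/

namespace Summit.KontsevichZagierPeriods.KontsevichZagierPeriods.Theorems

open MeasureTheory Set Literature.NumberTheory.Transcendental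
open Literature.NumberTheory.Transcendental.KZ

noncomputable section

/-! ## 1. Values and classes of the two representations -/

/-- `Z(3).value = ζ(3)`. -/
theorem soloInformedMzv3_value : soloInformedMzv3.value = multipleZeta [3] :=
  mzvRep_value_holds [3] _ _ _

/-- `Z(2,1).value = ζ(3)` (Euler). -/
theorem soloInformedMzv21_value : soloInformedMzv21.value = multipleZeta [3] := by
  rw [← euler_zeta_two_one_holds]; exact mzvRep_value_holds [2, 1] _ _ _

/-- `ζ(3) > 0`. -/
theorem soloInformed_zeta3_pos : 0 < multipleZeta [3] :=
  multipleZeta_pos_of_isAdmissible_holds (by decide : MZV.IsAdmissible [3])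

/-- Every weight-3 admissible simplex representation is `≡ Z(3)` modulo `relations`, with value `ζ(3)`
(for any choice of the admissibility / semialgebraicity / integrability proofs). -/
theorem soloInformed_mzvRep3_class (s : List ℕ) (hs : MZV.IsAdmissible s) (hw : MZV.weight s = 3)
    (h₁ : IsSemialgebraicFunOn ℚ (openOrderedSimplex (MZV.weight s)) (mzvIntegrand s))
    (h₂ : IntegrableOn (mzvIntegrand s) (openOrderedSimplex (MZV.weight s)) volume) :
    of (mzvRep s hs h₁ h₂) - of soloInformedMzv3 ∈ relations ∧
      (mzvRep s hs h₁ h₂).value = multipleZeta [3] := by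
  rw [mzvRep_value_holds s hs h₁ h₂]
  rcases MZV.eq_of_isAdmissible_of_weight_eq_three hs hw with rfl | rfl
  · have e : of (mzvRep [3] hs h₁ h₂) - of soloInformedMzv3 = 0 := sub_self _
    exact ⟨by rw [e]; exact relations.zero_mem, rfl⟩
  · have e : mzvRep [2, 1] hs h₁ h₂ = soloInformedMzv21 := rfl
    exact ⟨by rw [e]; exact soloInformed_M21_sub_M3_mem_relations, euler_zeta_two_one_holds⟩

/-! ## 2. The period conjecture on the weight-3 MZV sector -/

/-- **THEOREM XXXVI₃.** For admissible `s, s'` of weight `3`, the simplex representations `Z(s)`,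
`Z(s')` are equivalent under the three rules (unconditionally; their values agree by Euler). -/
theorem soloInformed_kzp_mzvRep_weight3 (s s' : List ℕ) (hs : MZV.IsAdmissible s)
    (hs' : MZV.IsAdmissible s') (hw : MZV.weight s = 3) (hw' : MZV.weight s' = 3)
    (h₁ : IsSemialgebraicFunOn ℚ (openOrderedSimplex (MZV.weight s)) (mzvIntegrand s))
    (h₂ : IntegrableOn (mzvIntegrand s) (openOrderedSimplex (MZV.weight s)) volume)
    (h₁' : IsSemialgebraicFunOn ℚ (openOrderedSimplex (MZV.weight s')) (mzvIntegrand s'))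
    (h₂' : IntegrableOn (mzvIntegrand s') (openOrderedSimplex (MZV.weight s')) volume) :
    Equivalent (mzvRep s hs h₁ h₂) (mzvRep s' hs' h₁' h₂') := by
  obtain ⟨hn, -⟩ := soloInformed_mzvRep3_class s hs hw h₁ h₂
  obtain ⟨hn', -⟩ := soloInformed_mzvRep3_class s' hs' hw' h₁' h₂'
  have hsplit : of (mzvRep s hs h₁ h₂) - of (mzvRep s' hs' h₁' h₂')
      = (of (mzvRep s hs h₁ h₂) - of soloInformedMzv3)
        - (of (mzvRep s' hs' h₁' h₂') - of soloInformedMzv3) := by abel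
  rw [Equivalent, hsplit]
  exact relations.sub_mem hn hn'

/-- The summit's shape on the weight-3 sector: equal values ⇒ equivalent (the hypothesis is not even
needed). -/
theorem soloInformed_kzp_mzvRep_weight3' (s s' : List ℕ) (hs : MZV.IsAdmissible s)
    (hs' : MZV.IsAdmissible s') (hw : MZV.weight s = 3) (hw' : MZV.weight s' = 3)
    (h₁ : IsSemialgebraicFunOn ℚ (openOrderedSimplex (MZV.weight s)) (mzvIntegrand s))
    (h₂ : IntegrableOn (mzvIntegrand s) (openOrderedSimplex (MZV.weight s)) volume)
    (h₁' : IsSemialgebraicFunOn ℚ (openOrderedSimplex (MZV.weight s')) (mzvIntegrand s'))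
    (h₂' : IntegrableOn (mzvIntegrand s') (openOrderedSimplex (MZV.weight s')) volume)
    (_h : (mzvRep s hs h₁ h₂).value = (mzvRep s' hs' h₁' h₂').value) :
    Equivalent (mzvRep s hs h₁ h₂) (mzvRep s' hs' h₁' h₂') :=
  soloInformed_kzp_mzvRep_weight3 s s' hs hs' hw hw' h₁ h₂ h₁' h₂'

/-- **THEOREM XXXVI₃′ (kernel form on the span).** On the subgroup of `FormalRep` spanned by
`[Z(3)], [Z(2,1)]`, the kernel of `KZ.eval` is exactly `KZ.relations`. -/
theorem soloInformed_kzp_weight3_span (a b : ℤ) :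
    eval (a • of soloInformedMzv3 + b • of soloInformedMzv21) = 0 ↔
    a • of soloInformedMzv3 + b • of soloInformedMzv21 ∈ relations := by
  constructor
  · intro h
    simp only [map_add, map_zsmul, eval_of, soloInformedMzv3_value, soloInformedMzv21_value,
      zsmul_eq_mul] at h
    have hmul : ((a + b : ℤ) : ℝ) * multipleZeta [3] = 0 := by
      push_cast; linear_combination h
    have hz : a + b = 0 := by
      exact_mod_cast (mul_eq_zero.1 hmul).resolve_right soloInformed_zeta3_pos.ne'
    have e : a • of soloInformedMzv3 + b • of soloInformedMzv21
        = b • (of soloInformedMzv21 - of soloInformedMzv3) + (a + b) • of soloInformedMzv3 := by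
      module
    rw [e, hz, zero_smul, add_zero]
    exact relations.zsmul_mem soloInformed_M21_sub_M3_mem_relations b
  · intro h
    exact (AddMonoidHom.mem_ker).1 (relations_le_ker_eval_holds h)

end

end Summit.KontsevichZagierPeriods.KontsevichZagierPeriods.Theorems
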